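import Summits.BirchSwinnertonDyer.Rank1Residual.AdditivePotMult.QuadraticBaseChangeDescentRankLeOneEach
import Summits.BirchSwinnertonDyer.Rank1Residual.Additive.TwistRamTransport
import HarnessLib

/-!
# (ram) READ ON `E` ITSELF for the canonical twist `E^{(p*)}`: the X4(M) class theorems of the
# T-MIL chain with every per-pair hypothesis on `E` except the twist's analytic rank
# (row T-MIL-R2, FILE J-4; seat n1011-p01 GEN 9)

HONEST FRAMING (cell `b2b-bsdres`, run/shared/lean/b2b/bsd-rank1-residual/, verbatim in every
file): the goal of the cell is to DELETE the COMBINATION-SHAPED residual classes of the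
Birch–Swinnerton-Dyer formula for ALL analytic-rank `≤ 1` elliptic curves over `ℚ` — "full BSD
formula for every rank `≤ 1` curve in class `C`" assembled STRICTLY from published theorems — so
that the rank-`≤ 1` remainder becomes exactly the CONSTRUCTION-SHAPED classes, which are TYPED
(missing-input `Prop`s), NOT attempted. This is not "finishing BSD". Sub-classes X3♯(M) / X4(M)
(additive, potentially multiplicative prime; base-change-and-descend): a RESEARCH ROUTE; they stay
CONSTRUCTION-SHAPED; nothing is booked by this file; no mark / label moved. THEOREMS ONLY: no
definition, no named fact, no `sorry`.

## What (row T-MIL-R2, FILE J-4)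

H-4b's sharpest X4(M)⁰ theorem `bsdp_of_classX4M_of_rankZero_twist_noMilne_of_addv_unramified_canonical`
reads Skinner's (ram) on the TWIST `Wd = C_d • W^{(d_K)}` (`hram : Ram Wd p`). For the canonical
field `|d_K| = p` the twist is by `d_K = p* ≡ 1 (mod 4)`, UNRAMIFIED at every `ℓ ≠ p`, so
multiplicative primes `ℓ ≠ p` and `v_ℓ(Δ_min)` are the same for `W` and `Wd` — seat additive-p4's
`mult_iff_of_twist_pStar` / `padicValInt_minimalDiscriminantInt_eq_of_twist_pStar`
(`Additive/TwistRamTransport`, Comalada 1994 §2 via the tree's unramified-twist Tate algorithm).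
Hence `Ram W p → Ram Wd p` (`ram_twist_of_ram_of_natAbs_discr`; additive-p4 proved the direction
`Ram Wd p → Ram W p` as `ram_of_twist_pStar`; together `ram_twist_iff_of_natAbs_discr`), and the
class theorems read (ram) on `E`:

* `bsdp_of_classX4M_of_rankZero_twist_noMilne_of_addv_unramified_canonical_of_ram` — **for
  `(E,p) ∈ X4(M)` of analytic rank `≤ 1` with `Ram E p`, and its canonical twist `E^{(p*)}` of
  analytic rank `0`: `BSD(E,p) ⇐ MissingPPartOverAt(E_K, p)`**, inputs {Skinner 2016 Thm. C, GZK,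
  modularity}; the ONLY per-pair hypothesis not on `E` is `r_an(E^{(p*)}) = 0`;
* `bsdp_of_classX4M_of_bsdp_twist_noMilne_of_addv_unramified_canonical` (FILE J-3) needs no (ram)
  at all (the twist's `BSD_p` is displayed) — recalled in the docstring only.

HONEST LIMITS: a re-reading of hypotheses, no new population; odd `p`; `|d_K| = p`; X4(M) stays
CONSTRUCTION-SHAPED; closes no class; moves no mark; 0 facts.

References: S. Comalada, J. Number Theory 49 (1994) §2; J. H. Silverman, *ATAEC* IV.9.4
[SilvermanATAEC1994]; C. Skinner, Pacific J. Math. 283 (2016) Thm. C [Skinner2016PacificMC].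
-/

noncomputable section

open scoped Classical NumberField

open WeierstrassCurve NumberField IsDedekindDomain Rat.HeightOneSpectrum
  Literature.NumberTheory.EllipticCurves Literature.NumberTheory.EllipticCurves.Rank1Residual
  Literature.NumberTheory.EllipticCurves.Rank1Residual.Typed
  Literature.NumberTheory.QuadraticFields
  Summit.BirchSwinnertonDyer.Rank1Residual.Additive

namespace Summit.BirchSwinnertonDyer.Rank1Residual.AdditivePotMult

section CanonicalRam

variable (W : WeierstrassCurve ℚ) [W.IsElliptic] [W.IsGloballyMinimal] (p : ℕ) [hp : Fact p.Prime]
  (K : Type) [Field K] [NumberField K]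
  (Wd : WeierstrassCurve ℚ) [Wd.IsElliptic] [Wd.IsGloballyMinimal]
  (W' : WeierstrassCurve K) [W'.IsElliptic] [W'.IsGloballyMinimal]

/-- **(ram) passes from `E` to its canonical twist**: for `[K:ℚ] = 2` with `|d_K| = p` odd and
`Wd = C_d • W^{(d_K)}` (both globally minimal), `Ram W p → Ram Wd p`. Indeed `d_K = ±p ≡ 1 (mod 4)`
(Stickelberger, tree `Quadratic.discr_emod_four`, and `d_K` odd), so the twist is unramified at the
witness prime `ℓ ≠ p`: `Mult W ℓ ↔ Mult Wd ℓ` and `v_ℓ(Δ_min(W)) = v_ℓ(Δ_min(Wd))` (additive-p4's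
`mult_iff_of_twist_pStar`, `padicValInt_minimalDiscriminantInt_eq_of_twist_pStar`).
[cite: SilvermanATAEC1994, IV.9.4] -/
theorem ram_twist_of_ram_of_natAbs_discr (h2 : Module.finrank ℚ K = 2)
    (hdK : (NumberField.discr K).natAbs = p) (hp2 : p ≠ 2)
    {Cd : VariableChange ℚ} (hWd : Cd • W.quadraticTwist (NumberField.discr K : ℚ) = Wd)
    (hram : Ram W p) : Ram Wd p := by
  have hdp : NumberField.discr K = p ∨ NumberField.discr K = -p := by
    rcases Int.natAbs_eq (NumberField.discr K) with h | h
    · exact Or.inl (by rw [h, hdK])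
    · exact Or.inr (by rw [h, hdK])
  have hpodd : Odd p := hp.out.odd_of_ne_two hp2
  have hd4 : NumberField.discr K % 4 = 1 := by
    rcases Quadratic.discr_emod_four h2 with h | h
    · exfalso
      obtain ⟨m, hm⟩ := hpodd
      rcases hdp with h' | h' <;> omega
    · exact h
  have hdk : NumberField.discr K = 4 * (NumberField.discr K / 4) + 1 := by omega
  obtain ⟨ℓ, hℓ, hℓp, hmult, hv⟩ := hram
  refine ⟨ℓ, hℓ, hℓp, (mult_iff_of_twist_pStar p W hdk hdp Cd hWd hℓp).mpr hmult, ?_⟩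
  rwa [padicValInt_minimalDiscriminantInt_eq_of_twist_pStar p W hdk hdp Cd hWd hℓp]

/-- **(ram) is the SAME condition on `E` and on its canonical twist**: `Ram W p ↔ Ram Wd p` for
`|d_K| = p` odd, `Wd = C_d • W^{(d_K)}` — `ram_twist_of_ram_of_natAbs_discr` and additive-p4's
`ram_of_twist_pStar` (the direction `Ram Wd p → Ram W p`). So the census column "(ram) for the twist"
of the X4(M)⁰ class theorems is the column "(ram) for `E`". [cite: SilvermanATAEC1994, IV.9.4] -/
theorem ram_twist_iff_of_natAbs_discr (h2 : Module.finrank ℚ K = 2)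
    (hdK : (NumberField.discr K).natAbs = p) (hp2 : p ≠ 2)
    {Cd : VariableChange ℚ} (hWd : Cd • W.quadraticTwist (NumberField.discr K : ℚ) = Wd) :
    Ram W p ↔ Ram Wd p := by
  refine ⟨ram_twist_of_ram_of_natAbs_discr W p K Wd h2 hdK hp2 hWd, fun hram => ?_⟩
  have hdp : NumberField.discr K = p ∨ NumberField.discr K = -p := by
    rcases Int.natAbs_eq (NumberField.discr K) with h | h
    · exact Or.inl (by rw [h, hdK])
    · exact Or.inr (by rw [h, hdK])
  have hpodd : Odd p := hp.out.odd_of_ne_two hp2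
  have hd4 : NumberField.discr K % 4 = 1 := by
    rcases Quadratic.discr_emod_four h2 with h | h
    · exfalso
      obtain ⟨m, hm⟩ := hpodd
      rcases hdp with h' | h' <;> omega
    · exact h
  have hdk : NumberField.discr K = 4 * (NumberField.discr K / 4) + 1 := by omega
  exact ram_of_twist_pStar p W hdk hdp Cd hWd hram

/-- **X4(M)⁰ WITH (ram) READ ON `E`: `BSD(E, p) ⇐ MissingPPartOverAt(E_K, p)`** for
`(E,p) ∈ X4(M)` of analytic rank `≤ 1` with `Ram W p` (a multiplicative prime `ℓ ≠ p` of `E` with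
`p ∤ v_ℓ(Δ_min(E))`), the quadratic field with `|d_K| = p`, `Wd = C_d • W^{(d_K)}` globally minimal
of analytic rank `0`, `W' = C' • W_K` globally minimal — inputs {Skinner 2016 Thm. C (`hSk`),
`hGZK`, `hmod`}; H-4b's `…_canonical` with `Ram Wd p` supplied by `ram_twist_of_ram_of_natAbs_discr`.
The only per-pair hypothesis not read on `E` is `r_an(Wd) = 0` (for `r_an(Wd) = 1` see FILE J-3's
`bsdp_of_classX4M_of_bsdp_twist_noMilne_of_addv_unramified_canonical`, where `BSD_p(Wd)` is
displayed and no (ram) is needed). [cite: Skinner2016PacificMC, Thm. C (§1), footnote 1, §2.5]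
[cite: SilvermanATAEC1994, IV.9.4 and V.5.3] -/
theorem bsdp_of_classX4M_of_rankZero_twist_noMilne_of_addv_unramified_canonical_of_ram
    (hGZK : rank_eq_analyticRank_of_analyticRank_le_one) (hmod : hasEntireLFunction_rat)
    (hSk : Skinner2016.thmC_padicValRat_bsd_rank_zero)
    (hX : ClassX4M W p) (hr : W.analyticRank ≤ 1) (hram : Ram W p) (h2 : Module.finrank ℚ K = 2)
    (hdK : (NumberField.discr K).natAbs = p)
    {Cd : VariableChange ℚ} (hWd : Cd • W.quadraticTwist (NumberField.discr K : ℚ) = Wd)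
    (hr0 : Wd.analyticRank = 0)
    {C' : VariableChange K} (hW' : C' • W.baseChange K = W')
    (hK : MissingPPartOverAt W' p) : BSDp W p :=
  bsdp_of_classX4M_of_rankZero_twist_noMilne_of_addv_unramified_canonical W p K Wd W' hGZK hmod hSk hX
    hr h2 hdK hWd (ram_twist_of_ram_of_natAbs_discr W p K Wd h2 hdK hX.p_ne_two hWd hram) hr0 hW' hK

end CanonicalRam

end Summit.BirchSwinnertonDyer.Rank1Residual.AdditivePotMult

end
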